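import Literature.AnabelianGeometry.SemiGraphs.TemperedVerticial
import Literature.AnabelianGeometry.SemiGraphs.SubdivisionLemmas
import HarnessLib

/-!
# The leaf-star semi-graph and the semi-graph of anabelioids `𝒢⋆` on it («RAYLESS-STAR·CIV-NEG», brick S1:
# the OBJECT)

Mochizuki, *Semi-graphs of anabelioids*, Publ. RIMS **42** (2006) 221–322, §1 p. 11 (semi-graphs),
Def 2.1 p. 22 (semi-graphs of anabelioids in the local presentation "semi-graph of profinite groups",
p. 23), Thm 3.7 (iii) p. 41 [cite: MochizukiSemiAnbd2006, Def 2.1 p.22].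

abc-iut cell, layer L3, row «RAYLESS-STAR·CIV-NEG» (L3-lead β77 (2); seat abc-iut-L3-t8 gen 6; desk memo
`HOME/staging/L3/L3-t8/g6/VERTICAL-ESCAPE-RAYLESS-STAR-L3t8g6.md` sha16 237f69233a585da2).  HONEST FRAMING:
towards a kernel erratum-class NEGATIVE VALUE for the ∀-countable reading of [SemiAnbd] Thm 3.7 (iii) at a
NEW carrier class — a countable RAYLESS star with one vertex of infinite valence (the ray carrier `𝒢_θ` is
`ThetaRayRefutation.lean`); print proves the FINITE-`𝔾` case (kernel: p431007
`compactInVerticialAt_of_finiteGraph`), which is the only case IUT consumes.  Nothing here asserts or refutes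
anything of [SemiAnbd]; it DEFINES an object (pattern of `ThetaRayGraph.lean`, brick R3 of REFUTE-F1732).
No side taken on [IUTchIII] Cor 3.12.

CONTENT (definitions + their elementary properties; BINDER form — the vertex groups `V v`, the edge group `E`
and the gluing homomorphisms are parameters, so that the free pro-`p` group of rank 2 at the centre
(`FreeProPRankTwo.Grp p`, gluings `θα p n : 1 ↦ a·b^{p^n}`) and the metabelian leaves `ℤ_p ⋊ ℤ_p` enter only at
instantiation):

* `SemiGraph.leafStar` — the star `𝔾⋆`: vertices `Option ℕ` (the centre `none`, the leaves `some n`), CLOSED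
  edges `e_n` (`n : ℕ`) with branches `β_n⁺ := (n, true) ↦ centre` and `β_n⁻ := (n, false) ↦ leaf n`; a
  countable, connected, untangled graph with a vertex, NOT locally finite (the centre has infinite valence),
  every leaf of valence one.
* `ProfiniteSemiGraph.starOfLeaves V E up low` — vertex groups `V v` (a DEPENDENT family: centre group
  `V none`, leaf groups `V (some n)`), all edge groups `E`, `brHom β_n⁺ := up n : E → V none`,
  `brHom β_n⁻ := low n : E → V (some n)`; branch subgroups in closed form; injective type from injective
  gluings; verticial slimness from slimness of the `V v`; the `Prop36Hypotheses` / `Thm37Hypotheses` bundles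
  ASSEMBLED from the remaining fields taken as named inputs (bricks S3/S4).
-/

namespace Literature.AnabelianGeometry.SemiGraphs

namespace SemiGraph

/-! ### The leaf-star -/

/-- The vertex of `𝔾⋆` a branch abuts to: `β_n⁺ = (n, true)` to the centre `none`, `β_n⁻ = (n, false)` to the
leaf `some n`. [cite: MochizukiSemiAnbd2006, §1 p.11] -/
def leafStarVertexOf : ℕ × Bool → Option ℕ
  | (_, true) => none
  | (n, false) => some n

/-- **The leaf-star** `𝔾⋆` ([SemiAnbd] §1 p. 11; the underlying semi-graph of the rayless counter-carrier
`𝒢⋆` of the desk memo §1): vertices `Option ℕ` (centre `none`, leaves `some n`), edges `e_n` (`n : ℕ`), each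
with the two branches `β_n⁺ = (n, true)`, abutting to the centre, and `β_n⁻ = (n, false)`, abutting to the leaf
`some n`. [cite: MochizukiSemiAnbd2006, §1 p.11] -/
abbrev leafStar : SemiGraph.{0} where
  Vertex := Option ℕ
  Edge := ℕ
  Branch := ℕ × Bool
  edgeOf b := b.1
  abuts b := some (leafStarVertexOf b)
  two_branches e := ⟨(e, false), (e, true), fun h => Bool.false_ne_true (congrArg Prod.snd h), rfl, rfl,
    fun b hb => by
    obtain ⟨e', c⟩ := b
    change e' = e at hb
    subst hb
    cases c
    · exact Or.inl rfl
    · exact Or.inr rfl⟩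

/-- The edge of a branch of the leaf-star. [cite: MochizukiSemiAnbd2006, §1 p.11] -/
@[simp] theorem leafStar_edgeOf (b : ℕ × Bool) : leafStar.edgeOf b = b.1 := rfl

/-- The branch `β_n⁺ = (n, true)` abuts to the centre. [cite: MochizukiSemiAnbd2006, §1 p.11] -/
@[simp] theorem leafStar_abuts_true (n : ℕ) : leafStar.abuts (n, true) = some none := rfl

/-- The branch `β_n⁻ = (n, false)` abuts to the leaf `n`. [cite: MochizukiSemiAnbd2006, §1 p.11] -/
@[simp] theorem leafStar_abuts_false (n : ℕ) : leafStar.abuts (n, false) = some (some n) := rfl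

/-- The coincidence map of the leaf-star in closed form. [cite: MochizukiSemiAnbd2006, §1 p.11] -/
theorem leafStar_abuts (b : ℕ × Bool) : leafStar.abuts b = some (leafStarVertexOf b) := rfl

/-- The leaf-star is a graph: every branch abuts to a vertex. [cite: MochizukiSemiAnbd2006, §1 p.11] -/
theorem leafStar_isGraph : leafStar.IsGraph := ⟨fun _ => rfl⟩

/-- The leaf-star is countable. [cite: MochizukiSemiAnbd2006, §1 p.11] -/
theorem leafStar_isCountable : leafStar.IsCountable :=
  ⟨(inferInstance : Countable (Option ℕ)), (inferInstance : Countable ℕ)⟩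

/-- The leaf-star has a vertex. [cite: MochizukiSemiAnbd2006, §1 p.11] -/
theorem leafStar_nonempty_vertex : Nonempty leafStar.Vertex := ⟨(none : Option ℕ)⟩

/-- The star of the centre: `b` abuts to the centre iff `b = β_n⁺` for its edge `n`.
[cite: MochizukiSemiAnbd2006, §1 p.13] -/
theorem leafStar_abuts_eq_some_none_iff {b : ℕ × Bool} : leafStar.abuts b = some none ↔ b = (b.1, true) := by
  obtain ⟨n, c⟩ := b
  cases c
  · simp [leafStarVertexOf]
  · simp [leafStarVertexOf]

/-- The star of the leaf `n` is the single branch `β_n⁻`. [cite: MochizukiSemiAnbd2006, §1 p.13] -/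
theorem leafStar_abuts_eq_some_some_iff {b : ℕ × Bool} {n : ℕ} :
    leafStar.abuts b = some (some n) ↔ b = (n, false) := by
  obtain ⟨m, c⟩ := b
  cases c
  · simp [leafStarVertexOf]
  · simp [leafStarVertexOf]

/-- The edge `e_n` abuts to the centre (through `β_n⁺`). [cite: MochizukiSemiAnbd2006, §1 p.11] -/
theorem leafStar_edgeAbuts_none (n : ℕ) : leafStar.EdgeAbuts n none := ⟨(n, true), rfl, rfl⟩

/-- The edge `e_n` abuts to the leaf `n` (through `β_n⁻`). [cite: MochizukiSemiAnbd2006, §1 p.11] -/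
theorem leafStar_edgeAbuts_some (n : ℕ) : leafStar.EdgeAbuts n (some n) := ⟨(n, false), rfl, rfl⟩

/-- The edge `e_n` abuts to `v` iff `v` is the centre or the leaf `n`. [cite: MochizukiSemiAnbd2006, §1 p.11] -/
theorem leafStar_edgeAbuts_iff {n : ℕ} {v : Option ℕ} : leafStar.EdgeAbuts n v ↔ v = none ∨ v = some n := by
  constructor
  · rintro ⟨⟨m, c⟩, he, hb⟩
    change m = n at he
    subst he
    cases c
    · right
      exact (Option.some.inj hb).symm
    · left
      exact (Option.some.inj hb).symm
  · rintro (h | h) <;> rw [h]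
    · exact leafStar_edgeAbuts_none n
    · exact leafStar_edgeAbuts_some n

/-- The edge `e_n` joins the leaf `n` to the centre. [cite: MochizukiSemiAnbd2006, §1 p.11] -/
theorem leafStar_joins (n : ℕ) : leafStar.Joins n (some n) none :=
  ⟨(n, false), (n, true), fun h => Bool.false_ne_true (congrArg Prod.snd h), rfl, rfl, rfl, rfl⟩

/-- The leaf-star is untangled: `e_n` joins the DISTINCT vertices leaf `n` and centre.
[cite: MochizukiSemiAnbd2006, §1 p.13] -/
theorem leafStar_isUntangled : leafStar.IsUntangled :=
  ⟨fun e _ => ⟨some e, none, Option.some_ne_none e, leafStar_joins e⟩⟩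

/-- Every edge abuts to the centre: the set of edges at the centre is all of `ℕ`.
[cite: MochizukiSemiAnbd2006, §1 p.13] -/
theorem leafStar_setOf_edgeAbuts_none : {e : ℕ | leafStar.EdgeAbuts e none} = Set.univ :=
  Set.eq_univ_of_forall fun n => leafStar_edgeAbuts_none n

/-- **The leaf-star is NOT locally finite**: the centre has infinite valence.
[cite: MochizukiSemiAnbd2006, §1 p.13] -/
theorem leafStar_not_isLocallyFinite : ¬ leafStar.IsLocallyFinite := fun h => by
  have hfin := h.finite_edges none
  rw [leafStar_setOf_edgeAbuts_none] at hfin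
  exact Set.infinite_univ hfin

/-- The branches at the centre form an infinite set (one per edge). [cite: MochizukiSemiAnbd2006, §1 p.13] -/
theorem leafStar_infinite_star_none : {b : ℕ × Bool | leafStar.abuts b = some none}.Infinite := by
  have hinj : Function.Injective (fun n : ℕ => ((n, true) : ℕ × Bool)) := fun m n h => congrArg Prod.fst h
  refine Set.infinite_of_injective_forall_mem hinj fun n => ?_
  exact leafStar_abuts_true n

/-- The branches at a leaf form the singleton `{β_n⁻}`. [cite: MochizukiSemiAnbd2006, §1 p.13] -/
theorem leafStar_star_some_eq (n : ℕ) : {b : ℕ × Bool | leafStar.abuts b = some (some n)} = {(n, false)} := by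
  ext b
  exact leafStar_abuts_eq_some_some_iff

/-- The star of a leaf is finite (valence one). [cite: MochizukiSemiAnbd2006, §1 p.13] -/
theorem leafStar_finite_star_some (n : ℕ) : {b : ℕ × Bool | leafStar.abuts b = some (some n)}.Finite := by
  rw [leafStar_star_some_eq]
  exact Set.finite_singleton _

/-- Every vertex-point of the subdivision of the leaf-star is reachable from the centre (along
`centre — β_n⁺ — e_n — β_n⁻ — leaf n`). [cite: MochizukiSemiAnbd2006, §1 pp.11-13] -/
theorem leafStar_reachable_vertex (v : Option ℕ) :
    leafStar.subdivision.Reachable (Sum.inl (none : Option ℕ)) (Sum.inl v) := by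
  cases v with
  | none => exact SimpleGraph.Reachable.refl _
  | some n =>
    have h1 : leafStar.subdivision.Adj (Sum.inr (Sum.inr ((n, true) : ℕ × Bool))) (Sum.inl none) :=
      leafStar.subdivision_adj_of_nodeRel (NodeRel.branch_vertex (G := leafStar) (n, true) none rfl)
    have h2 : leafStar.subdivision.Adj (Sum.inr (Sum.inl n)) (Sum.inr (Sum.inr ((n, true) : ℕ × Bool))) :=
      leafStar.subdivision_adj_of_nodeRel (NodeRel.edge_branch (G := leafStar) (n, true))
    have h3 : leafStar.subdivision.Adj (Sum.inr (Sum.inl n)) (Sum.inr (Sum.inr ((n, false) : ℕ × Bool))) :=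
      leafStar.subdivision_adj_of_nodeRel (NodeRel.edge_branch (G := leafStar) (n, false))
    have h4 : leafStar.subdivision.Adj (Sum.inr (Sum.inr ((n, false) : ℕ × Bool))) (Sum.inl (some n)) :=
      leafStar.subdivision_adj_of_nodeRel (NodeRel.branch_vertex (G := leafStar) (n, false) (some n) rfl)
    exact ((h1.symm.reachable.trans h2.symm.reachable).trans h3.reachable).trans h4.reachable

/-- Every point of the subdivision of the leaf-star is reachable from the centre.
[cite: MochizukiSemiAnbd2006, §1 pp.11-13] -/
theorem leafStar_reachable (x : leafStar.Node) : leafStar.subdivision.Reachable (Sum.inl (none : Option ℕ)) x := by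
  have hed : ∀ e : ℕ, leafStar.subdivision.Reachable (Sum.inl (none : Option ℕ)) (Sum.inr (Sum.inl e)) :=
    fun e =>
    ((leafStar.subdivision_adj_of_nodeRel
        (NodeRel.branch_vertex (G := leafStar) (e, true) none rfl)).symm.reachable).trans
      (leafStar.subdivision_adj_of_nodeRel (NodeRel.edge_branch (G := leafStar) ((e, true) : ℕ × Bool))).symm.reachable
  rcases x with v | e | b
  · exact leafStar_reachable_vertex v
  · exact hed e
  · exact (hed b.1).trans (leafStar.subdivision_adj_of_nodeRel (NodeRel.edge_branch (G := leafStar) b)).reachable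

/-- **The leaf-star is connected.** [cite: MochizukiSemiAnbd2006, §1 pp.11-13] -/
theorem leafStar_isConnected : leafStar.IsConnected := by
  haveI : Nonempty leafStar.Node := ⟨Sum.inl (none : Option ℕ)⟩
  exact ⟨⟨fun x y => (leafStar_reachable x).symm.trans (leafStar_reachable y)⟩⟩

end SemiGraph

/-! ### The semi-graph of anabelioids `𝒢⋆` on the leaf-star -/

namespace ProfiniteSemiGraph

section StarOfLeaves

variable (V : Option ℕ → Type) [∀ v, Group (V v)] [∀ v, TopologicalSpace (V v)]
  [∀ v, IsTopologicalGroup (V v)] [∀ v, CompactSpace (V v)] [∀ v, TotallyDisconnectedSpace (V v)]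
  (E : Type) [Group E] [TopologicalSpace E] [IsTopologicalGroup E] [CompactSpace E]
  [TotallyDisconnectedSpace E] (up : ℕ → (E →ₜ* V none)) (low : ∀ n : ℕ, E →ₜ* V (some n))

/-- The gluing along a branch, indexed by the branch alone: `up n` at `β_n⁺` (into the centre group
`V none`) and `low n` at `β_n⁻` (into the leaf group `V (some n)`). [cite: MochizukiSemiAnbd2006, Def 2.1 p.22] -/
def starGluing : ∀ b : ℕ × Bool, E →ₜ* V (SemiGraph.leafStarVertexOf b)
  | (n, true) => up n
  | (n, false) => low n

/-- **`𝒢⋆` in binder form** ([SemiAnbd] Def 2.1 p. 22, local presentation p. 23; the desk memo's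
counter-carrier shape, §1): on the leaf-star, the vertex group at `v` is `V v` (centre `V none`, leaves
`V (some n)`), every edge group is `E`, the branch `β_n⁺` of `e_n` (abutting to the centre) is glued by
`up n : E → V none` (memo: `1 ↦ y·x^{p^n}`) and the branch `β_n⁻` (abutting to the leaf `n`) by
`low n : E → V (some n)` (memo: `1 ↦ σ_n`).  A DEFINITION; nothing is asserted about [SemiAnbd] Thm 3.7.
[cite: MochizukiSemiAnbd2006, Def 2.1 p.22] -/
def starOfLeaves : ProfiniteSemiGraph.{0} where
  graph := SemiGraph.leafStar
  Gv := V
  Ge _ := E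
  brHom b _ h := (Option.some.inj h) ▸ starGluing V E up low b

/-- The underlying semi-graph of `𝒢⋆` is the leaf-star. [cite: MochizukiSemiAnbd2006, Def 2.1 p.22] -/
@[simp] theorem starOfLeaves_graph : (starOfLeaves V E up low).graph = SemiGraph.leafStar := rfl

/-- The vertex group of `𝒢⋆` at `v` is `V v`. [cite: MochizukiSemiAnbd2006, Def 2.1 p.22] -/
@[simp] theorem starOfLeaves_Gv (v : Option ℕ) : (starOfLeaves V E up low).Gv v = V v := rfl

/-- Every edge group of `𝒢⋆` is `E`. [cite: MochizukiSemiAnbd2006, Def 2.1 p.22] -/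
@[simp] theorem starOfLeaves_Ge (e : ℕ) : (starOfLeaves V E up low).Ge e = E := rfl

/-- The gluing along a branch at the vertex it abuts to is `starGluing`.
[cite: MochizukiSemiAnbd2006, Def 2.1 p.22] -/
theorem starOfLeaves_brHom_self (b : ℕ × Bool) (h : SemiGraph.leafStar.abuts b = some (SemiGraph.leafStarVertexOf b)) :
    (starOfLeaves V E up low).brHom b (SemiGraph.leafStarVertexOf b) h = starGluing V E up low b := rfl

/-- The gluing along `β_n⁺` (into the centre group) is `up n`. [cite: MochizukiSemiAnbd2006, Def 2.1 p.22] -/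
@[simp] theorem starOfLeaves_brHom_true (n : ℕ) (h : SemiGraph.leafStar.abuts (n, true) = some none) :
    (starOfLeaves V E up low).brHom (n, true) none h = up n := rfl

/-- The gluing along `β_n⁻` (into the leaf group `V (some n)`) is `low n`.
[cite: MochizukiSemiAnbd2006, Def 2.1 p.22] -/
@[simp] theorem starOfLeaves_brHom_false (n : ℕ) (h : SemiGraph.leafStar.abuts (n, false) = some (some n)) :
    (starOfLeaves V E up low).brHom (n, false) (some n) h = low n := rfl

/-- The gluing along any branch, after identifying the abutment vertex: transport of `starGluing`.
[cite: MochizukiSemiAnbd2006, Def 2.1 p.22] -/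
theorem starOfLeaves_brHom (b : ℕ × Bool) (v : Option ℕ) (h : SemiGraph.leafStar.abuts b = some v) :
    (starOfLeaves V E up low).brHom b v h = (Option.some.inj h) ▸ starGluing V E up low b := rfl

/-- The branch subgroup `Π_{β_n⁺} ⊆ Π_{centre}` is the image of `up n` (memo: `⟨y·x^{p^n}⟩‾`).
[cite: MochizukiSemiAnbd2006, §2 p.23] -/
theorem starOfLeaves_branchSubgroup_true (n : ℕ) (h : SemiGraph.leafStar.abuts (n, true) = some none) :
    (starOfLeaves V E up low).branchSubgroup (n, true) none h = (up n).toMonoidHom.range := rfl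

/-- The branch subgroup `Π_{β_n⁻} ⊆ Π_{leaf n}` is the image of `low n` (memo: `⟨σ_n⟩‾`).
[cite: MochizukiSemiAnbd2006, §2 p.23] -/
theorem starOfLeaves_branchSubgroup_false (n : ℕ) (h : SemiGraph.leafStar.abuts (n, false) = some (some n)) :
    (starOfLeaves V E up low).branchSubgroup (n, false) (some n) h = (low n).toMonoidHom.range := rfl

/-- A branch abutting to the centre is some `β_n⁺`, and its branch subgroup is the image of `up n`.
[cite: MochizukiSemiAnbd2006, §2 p.23] -/
theorem starOfLeaves_branchSubgroup_none (b : ℕ × Bool) (h : SemiGraph.leafStar.abuts b = some none) :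
    b = (b.1, true) ∧ (starOfLeaves V E up low).branchSubgroup b none h = (up b.1).toMonoidHom.range := by
  have hb : b = (b.1, true) := SemiGraph.leafStar_abuts_eq_some_none_iff.mp h
  refine ⟨hb, ?_⟩
  obtain ⟨n, c⟩ := b
  cases c
  · exact absurd (congrArg Prod.snd hb) Bool.false_ne_true
  · rfl

/-- A branch abutting to the leaf `n` is `β_n⁻`, and its branch subgroup is the image of `low n`.
[cite: MochizukiSemiAnbd2006, §2 p.23] -/
theorem starOfLeaves_branchSubgroup_some (b : ℕ × Bool) (n : ℕ) (h : SemiGraph.leafStar.abuts b = some (some n)) :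
    b = (n, false) ∧ (starOfLeaves V E up low).branchSubgroup b (some n) h = (low n).toMonoidHom.range := by
  have hb : b = (n, false) := SemiGraph.leafStar_abuts_eq_some_some_iff.mp h
  subst hb
  exact ⟨rfl, rfl⟩

/-! #### (H1) of `Prop36Hypotheses` for `𝒢⋆` -/

/-- `𝒢⋆` is connected. [cite: MochizukiSemiAnbd2006, Prop 3.6 p.38] -/
theorem starOfLeaves_isConnected : (starOfLeaves V E up low).IsConnected := SemiGraph.leafStar_isConnected

/-- `𝒢⋆` is countable. [cite: MochizukiSemiAnbd2006, Prop 3.6 p.38] -/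
theorem starOfLeaves_isCountable : (starOfLeaves V E up low).IsCountable := SemiGraph.leafStar_isCountable

/-- `𝒢⋆` has a vertex. [cite: MochizukiSemiAnbd2006, Prop 3.6 p.38] -/
theorem starOfLeaves_hasVertex : (starOfLeaves V E up low).HasVertex := SemiGraph.leafStar_nonempty_vertex

/-- `𝒢⋆` is a graph (of anabelioids): every branch abuts. [cite: MochizukiSemiAnbd2006, Def 2.1 p.22] -/
theorem starOfLeaves_isGraph : (starOfLeaves V E up low).IsGraph := SemiGraph.leafStar_isGraph

/-- The underlying semi-graph of `𝒢⋆` is not locally finite (the centre has infinite valence) — the carrier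
lies OUTSIDE the locally finite regime of `compactInVerticialAt_or_horizontalEscape`.
[cite: MochizukiSemiAnbd2006, §1 p.13] -/
theorem starOfLeaves_not_isLocallyFinite : ¬ (starOfLeaves V E up low).graph.IsLocallyFinite :=
  SemiGraph.leafStar_not_isLocallyFinite

/-- `𝒢⋆` is of injective type as soon as all gluing homomorphisms are injective.
[cite: MochizukiSemiAnbd2006, Def 2.1 p.22] -/
theorem starOfLeaves_isOfInjectiveType (hup : ∀ n, Function.Injective (up n))
    (hlow : ∀ n, Function.Injective (low n)) : (starOfLeaves V E up low).IsOfInjectiveType := by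
  intro b v h
  have hv : SemiGraph.leafStarVertexOf b = v := Option.some.inj h
  subst hv
  rw [starOfLeaves_brHom_self]
  obtain ⟨n, c⟩ := b
  cases c
  · exact hlow n
  · exact hup n

/-- `𝒢⋆` is verticially slim as soon as every `V v` is slim. [cite: MochizukiSemiAnbd2006, Def 2.4 (ii) p.25] -/
theorem starOfLeaves_isVerticiallySlim
    (hV : ∀ v, Literature.AlgebraicGeometry.Frobenioids.IsSlimGroup (V v)) :
    (starOfLeaves V E up low).IsVerticiallySlim := fun v => hV v

/-- `𝒢⋆` is totally aloof as soon as it is totally estranged (Rmk. 2.4.1 "estranged implies aloof", built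
into `IsEstrangedEdge`). [cite: MochizukiSemiAnbd2006, Rmk 2.4.1 p.26] -/
theorem starOfLeaves_isTotallyAloof_of_isTotallyEstranged
    (h : (starOfLeaves V E up low).IsTotallyEstranged) : (starOfLeaves V E up low).IsTotallyAloof :=
  fun e => (h e).1

/-- **`Prop36Hypotheses 𝒢⋆` assembled**: (H1) from this file (connected, countable, has a vertex, injective
type from injective gluings), verticial slimness from slim `V v`, and Galois-countability, quasi-coherence,
total elevation and total aloofness as named inputs (bricks S3/S4). [cite: MochizukiSemiAnbd2006, Prop 3.6 p.38] -/
theorem starOfLeaves_prop36Hypotheses (hup : ∀ n, Function.Injective (up n))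
    (hlow : ∀ n, Function.Injective (low n))
    (hslim : ∀ v, Literature.AlgebraicGeometry.Frobenioids.IsSlimGroup (V v))
    (hGC : (starOfLeaves V E up low).IsGaloisCountable) (hQC : (starOfLeaves V E up low).IsQuasiCoherent)
    (hTE : (starOfLeaves V E up low).IsTotallyElevated) (hTA : (starOfLeaves V E up low).IsTotallyAloof) :
    (starOfLeaves V E up low).Prop36Hypotheses where
  isConnected := starOfLeaves_isConnected V E up low
  isCountable := starOfLeaves_isCountable V E up low
  isGaloisCountable := hGC
  hasVertex := starOfLeaves_hasVertex V E up low
  isOfInjectiveType := starOfLeaves_isOfInjectiveType V E up low hup hlow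
  isQuasiCoherent := hQC
  isTotallyElevated := hTE
  isTotallyAloof := hTA
  isVerticiallySlim := starOfLeaves_isVerticiallySlim V E up low hslim

/-- **`Thm37Hypotheses 𝒢⋆` assembled** (total aloofness read off total estrangedness).
[cite: MochizukiSemiAnbd2006, Thm 3.7 p.40] -/
theorem starOfLeaves_thm37Hypotheses (hup : ∀ n, Function.Injective (up n))
    (hlow : ∀ n, Function.Injective (low n))
    (hslim : ∀ v, Literature.AlgebraicGeometry.Frobenioids.IsSlimGroup (V v))
    (hGC : (starOfLeaves V E up low).IsGaloisCountable) (hQC : (starOfLeaves V E up low).IsQuasiCoherent)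
    (hTE : (starOfLeaves V E up low).IsTotallyElevated) (hTEs : (starOfLeaves V E up low).IsTotallyEstranged) :
    (starOfLeaves V E up low).Thm37Hypotheses where
  toProp36Hypotheses := starOfLeaves_prop36Hypotheses V E up low hup hlow hslim hGC hQC hTE
    (starOfLeaves_isTotallyAloof_of_isTotallyEstranged V E up low hTEs)
  isTotallyEstranged := hTEs

end StarOfLeaves

end ProfiniteSemiGraph

end Literature.AnabelianGeometry.SemiGraphs
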